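import Summits.BirchSwinnertonDyer.BirchSwinnertonDyer.Theorems.CyclotomicUntwistSigmaLineFamilyLevelOneDatum
import Literature.NumberTheory.EllipticCurves.CanonicalPAdicHeightAdmissibleProofs
import Literature.NumberTheory.EllipticCurves.CanonicalPAdicHeightAdmissibilityCriteria
import HarnessLib

/-!
# Route `CyclotomicUntwist`, crux K1 `PSRankOneLowerHalfAtThree` (stmt-BirchSwinnertonDyer-21580):
# the σ-LINE FAMILY — CONSEQUENCES OF THE LEVEL-ONE DATUM: the parallelogram law of the σ_c-heights on
# the WHOLE admissible locus, the datum read off ANY admissible multiple, independence of the multiple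

Cell `pub/bsd-wall` (D-0145 line `route-BirchSwinnertonDyer-CyclotomicUntwist`), seat `bsd-line-cycu-p1`
g5, lane «σ-LINE FAMILY LAW — LEVEL-ONE DATUM», file 29 of the lane. THEOREMS ONLY (no definition, no
named fact, no `sorry`); helper `--supports` K1 = stmt-BirchSwinnertonDyer-21580. BSD is not proved by
this file and no crux is.

WHAT. Once the σ_c-height `h = CensusX42.sigmaHeight W p σ_c` (`p ≥ 3`, `‖c‖ ≤ 1`, `W/ℚ` globally minimal)
is the quadratic form of a bilinear datum on ALL admissible points (`…LevelOneDatum`), the standard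
Mazur–Stein–Tate bookkeeping follows with no further analysis:

* **`sigmaHeight_formalSigma_parallelogram_admissible`** — `h(P+Q) + h(P−Q) = 2h(P) + 2h(Q)` whenever
  `P, Q, P+Q, P−Q` are admissible (g4's `…Parallelogram` / `…LevelTwoDatum` needed `‖x‖ > p⁴` / `> p²`);
* **`pairing_self_eq_sigmaHeight_nsmul_div`** — for the level-one datum `D` and ANY rational point `P`,
  `D(P,P) = h(mP)/m²` for every `m ≠ 0` with `mP` admissible (MST 2006 Alg. 3.4 Step 1, with the
  auxiliary multiple only required to be ADMISSIBLE, not deep);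
* **`sigmaHeight_nsmul_div_sq_eq`** — independence of the auxiliary multiple: `h(mP)/m² = h(m'P)/m'²`
  for two admissible multiples (datum-free statement);
* `pairing_eq_sigmaHeight_polarization` — `D(P,Q) = (h(m(P+Q)) − h(mP) − h(mQ))/(2m²)` when the three
  multiples are admissible;
* `exists_nsmul_isAdmissible_and_pairing_self_eq` — every non-torsion `P` HAS an admissible multiple
  (tree `exists_admissible_nsmul_holds`), so `D(P,P)` is computed by σ_c-heights.

References: Mazur–Stein–Tate 2006 §1 (1.1)–(1.3), Alg. 3.4; Stein–Wuthrich 2013 §4.1; Bernardi 1981 §1.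
[cite: MazurSteinTate2006, §2.7] [cite: SteinWuthrich2013, §4.1 eq. (4.1)]
-/

set_option autoImplicit false
-- single-conjunct summit: `Summit.BirchSwinnertonDyer.BirchSwinnertonDyer.…` repeats the name by design
set_option linter.dupNamespace false

noncomputable section

open scoped Classical

open PowerSeries WeierstrassCurve Literature.NumberTheory.EllipticCurves
  Summit.BirchSwinnertonDyer.Rank1Residual.Additive
  Summit.BirchSwinnertonDyer.BirchSwinnertonDyer.Theorems.PSSigmaLineFamilyLevelOneDatum

namespace Summit.BirchSwinnertonDyer.BirchSwinnertonDyer.Theorems.PSSigmaLineFamilyLevelOneConsequences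

variable {p : ℕ} [Fact p.Prime] (W : WeierstrassCurve ℚ) [W.IsElliptic] [W.IsGloballyMinimal]

/-! ### §1 The parallelogram law on the whole admissible locus -/

omit [W.IsElliptic] [W.IsGloballyMinimal] in
/-- Bilinear algebra: `D(P+Q,P+Q) + D(P−Q,P−Q) = 2D(P,P) + 2D(Q,Q)`. [folklore] -/
theorem pairing_parallelogram (D : PAdicHeightData W p) (P Q : W.toAffine.Point) :
    D.pairing (P + Q) (P + Q) + D.pairing (P - Q) (P - Q) = 2 * D.pairing P P + 2 * D.pairing Q Q := by
  simp only [map_add, map_sub, AddMonoidHom.add_apply, AddMonoidHom.sub_apply, D.symm Q P]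
  ring

/-- **PARALLELOGRAM LAW OF THE σ_c-HEIGHTS ON THE WHOLE ADMISSIBLE LOCUS** (`p ≥ 3`, `‖c‖_p ≤ 1`, `W`
globally minimal): if `P, Q, P + Q, P − Q` are admissible (`WeierstrassCurve.IsAdmissible p`: `‖x‖_p > 1`,
non-singular reduction everywhere) then `h(P+Q) + h(P−Q) = 2h(P) + 2h(Q)` for
`h = CensusX42.sigmaHeight W p σ_c` — from the level-one datum, no theta functions at the boundary needed.
[Mazur–Stein–Tate 2006, §1; Bernardi 1981, §1] [cite: MazurSteinTate2006, §2.7] -/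
theorem sigmaHeight_formalSigma_parallelogram_admissible (hp3 : 3 ≤ p) {c : ℚ_[p]} (hc : ‖c‖ ≤ 1)
    {P Q : W.toAffine.Point} (hP : W.IsAdmissible p P) (hQ : W.IsAdmissible p Q)
    (hS : W.IsAdmissible p (P + Q)) (hD : W.IsAdmissible p (P - Q)) :
    CensusX42.sigmaHeight W p ((W.baseChange ℚ_[p]).formalSigma c) (P + Q) +
        CensusX42.sigmaHeight W p ((W.baseChange ℚ_[p]).formalSigma c) (P - Q) =
      2 * CensusX42.sigmaHeight W p ((W.baseChange ℚ_[p]).formalSigma c) P +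
        2 * CensusX42.sigmaHeight W p ((W.baseChange ℚ_[p]).formalSigma c) Q := by
  obtain ⟨D, hDat⟩ := exists_heightDatum_formalSigma_levelOne W hp3 hc
  rw [← pairing_eq_sigmaHeight_of_isAdmissible W hDat hS, ← pairing_eq_sigmaHeight_of_isAdmissible W hDat hD,
    ← pairing_eq_sigmaHeight_of_isAdmissible W hDat hP, ← pairing_eq_sigmaHeight_of_isAdmissible W hDat hQ]
  exact pairing_parallelogram W D P Q

/-! ### §2 The datum from admissible multiples -/

omit [W.IsElliptic] [W.IsGloballyMinimal] in
/-- Bilinear algebra: `D(mP, mP) = m²·D(P,P)`. [folklore] -/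
theorem pairing_nsmul_nsmul (D : PAdicHeightData W p) (P : W.toAffine.Point) (m : ℕ) :
    D.pairing (m • P) (m • P) = (m : ℚ_[p]) ^ 2 * D.pairing P P := by
  rw [map_nsmul, D.symm (m • P) P, map_nsmul, smul_smul, nsmul_eq_mul]
  push_cast; ring

omit [W.IsElliptic] [W.IsGloballyMinimal] in
/-- **`D(P,P) = h(mP)/m²` for ANY admissible multiple.** For a datum `D` reading `h_{σ_c}` on the
admissible locus, every rational point `P` and every `m ≠ 0` with `mP` admissible:
`D(P,P) = h_{σ_c}(mP)/m²` (Mazur–Stein–Tate's Step 1 with the auxiliary multiple only ADMISSIBLE).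
[Mazur–Stein–Tate 2006, §1 eq. (1.3) and Alg. 3.4 Step 1] [cite: MazurSteinTate2006, §2.7] -/
theorem pairing_self_eq_sigmaHeight_nsmul_div {c : ℚ_[p]} {D : PAdicHeightData W p}
    (hD : ∀ {x y : ℚ} (h : W.toAffine.Nonsingular x y),
      1 < ‖(x : ℚ_[p])‖ → (∀ ℓ : ℕ, ℓ.Prime → W.HasNonsingularReductionAt ℓ x y) →
        D.pairing (.some x y h) (.some x y h) =
          CensusX42.sigmaHeight W p ((W.baseChange ℚ_[p]).formalSigma c) (.some x y h))
    (P : W.toAffine.Point) {m : ℕ} (hm : m ≠ 0) (hadm : W.IsAdmissible p (m • P)) :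
    D.pairing P P = CensusX42.sigmaHeight W p ((W.baseChange ℚ_[p]).formalSigma c) (m • P) / (m : ℚ_[p]) ^ 2 := by
  have hm' : (m : ℚ_[p]) ^ 2 ≠ 0 := pow_ne_zero 2 (Nat.cast_ne_zero.mpr hm)
  rw [← pairing_eq_sigmaHeight_of_isAdmissible W hD hadm, pairing_nsmul_nsmul W D P m,
    mul_div_cancel_left₀ _ hm']

/-- **INDEPENDENCE OF THE AUXILIARY MULTIPLE** (datum-free): for `p ≥ 3`, `‖c‖ ≤ 1`, any rational point
`P` and `m, m' ≠ 0` with `mP`, `m'P` admissible, `h_{σ_c}(mP)/m² = h_{σ_c}(m'P)/m'²`.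
[Mazur–Stein–Tate 2006, §1 (well-definedness of (1.3))] [cite: MazurSteinTate2006, §2.7] -/
theorem sigmaHeight_nsmul_div_sq_eq (hp3 : 3 ≤ p) {c : ℚ_[p]} (hc : ‖c‖ ≤ 1) (P : W.toAffine.Point)
    {m m' : ℕ} (hm : m ≠ 0) (hm' : m' ≠ 0) (hadm : W.IsAdmissible p (m • P))
    (hadm' : W.IsAdmissible p (m' • P)) :
    CensusX42.sigmaHeight W p ((W.baseChange ℚ_[p]).formalSigma c) (m • P) / (m : ℚ_[p]) ^ 2 =
      CensusX42.sigmaHeight W p ((W.baseChange ℚ_[p]).formalSigma c) (m' • P) / (m' : ℚ_[p]) ^ 2 := by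
  obtain ⟨D, hD⟩ := exists_heightDatum_formalSigma_levelOne W hp3 hc
  rw [← pairing_self_eq_sigmaHeight_nsmul_div W hD P hm hadm,
    ← pairing_self_eq_sigmaHeight_nsmul_div W hD P hm' hadm']

omit [W.IsElliptic] [W.IsGloballyMinimal] in
/-- **Polarization**: `D(P,Q) = (h(m(P+Q)) − h(mP) − h(mQ))/(2m²)` when `mP, mQ, m(P+Q)` are admissible.
[Mazur–Stein–Tate 2006, §1 eq. (1.2)] [cite: MazurSteinTate2006, §2.7] -/
theorem pairing_eq_sigmaHeight_polarization {c : ℚ_[p]} {D : PAdicHeightData W p}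
    (hD : ∀ {x y : ℚ} (h : W.toAffine.Nonsingular x y),
      1 < ‖(x : ℚ_[p])‖ → (∀ ℓ : ℕ, ℓ.Prime → W.HasNonsingularReductionAt ℓ x y) →
        D.pairing (.some x y h) (.some x y h) =
          CensusX42.sigmaHeight W p ((W.baseChange ℚ_[p]).formalSigma c) (.some x y h))
    (P Q : W.toAffine.Point) {m : ℕ} (hm : m ≠ 0) (hP : W.IsAdmissible p (m • P))
    (hQ : W.IsAdmissible p (m • Q)) (hS : W.IsAdmissible p (m • (P + Q))) :
    D.pairing P Q =
      (CensusX42.sigmaHeight W p ((W.baseChange ℚ_[p]).formalSigma c) (m • (P + Q)) -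
          CensusX42.sigmaHeight W p ((W.baseChange ℚ_[p]).formalSigma c) (m • P) -
          CensusX42.sigmaHeight W p ((W.baseChange ℚ_[p]).formalSigma c) (m • Q)) /
        (2 * (m : ℚ_[p]) ^ 2) := by
  have hm' : (m : ℚ_[p]) ^ 2 ≠ 0 := pow_ne_zero 2 (Nat.cast_ne_zero.mpr hm)
  rw [← pairing_eq_sigmaHeight_of_isAdmissible W hD hS, ← pairing_eq_sigmaHeight_of_isAdmissible W hD hP,
    ← pairing_eq_sigmaHeight_of_isAdmissible W hD hQ, pairing_nsmul_nsmul, pairing_nsmul_nsmul,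
    pairing_nsmul_nsmul]
  simp only [map_add, AddMonoidHom.add_apply, D.symm Q P]
  field_simp
  ring

/-- **Every non-torsion point is reached**: for the level-one datum `D` and every non-torsion `P ∈ E(ℚ)`
there is `m ≠ 0` with `mP` admissible (tree `exists_admissible_nsmul_holds`) and
`D(P,P) = h_{σ_c}(mP)/m²`. So the datum is COMPUTED by σ_c-heights of admissible multiples.
[Mazur–Stein–Tate 2006, §1 and Alg. 3.4] [cite: MazurSteinTate2006, §2.7] -/
theorem exists_nsmul_isAdmissible_and_pairing_self_eq {c : ℚ_[p]} {D : PAdicHeightData W p}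
    (hD : ∀ {x y : ℚ} (h : W.toAffine.Nonsingular x y),
      1 < ‖(x : ℚ_[p])‖ → (∀ ℓ : ℕ, ℓ.Prime → W.HasNonsingularReductionAt ℓ x y) →
        D.pairing (.some x y h) (.some x y h) =
          CensusX42.sigmaHeight W p ((W.baseChange ℚ_[p]).formalSigma c) (.some x y h))
    (P : W.toAffine.Point) (hP : ¬ IsOfFinAddOrder P) :
    ∃ m : ℕ, m ≠ 0 ∧ W.IsAdmissible p (m • P) ∧
      D.pairing P P = CensusX42.sigmaHeight W p ((W.baseChange ℚ_[p]).formalSigma c) (m • P) / (m : ℚ_[p]) ^ 2 := by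
  obtain ⟨m, hm, hadm⟩ := exists_admissible_nsmul_holds W p P hP
  exact ⟨m, hm, hadm, pairing_self_eq_sigmaHeight_nsmul_div W hD P hm hadm⟩

omit [W.IsElliptic] [W.IsGloballyMinimal] in
/-- And torsion points pair to zero (bookkeeping). [folklore] -/
theorem pairing_self_eq_zero_of_isOfFinAddOrder (D : PAdicHeightData W p) {P : W.toAffine.Point}
    (hP : IsOfFinAddOrder P) : D.pairing P P = 0 :=
  D.map_torsion P P hP

end Summit.BirchSwinnertonDyer.BirchSwinnertonDyer.Theorems.PSSigmaLineFamilyLevelOneConsequences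

end
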